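import Mathlib
import Summits.Ventures.HodgeRepro.Tier4.Line4.MainTermInstance

/-!
# Tier4/Line4/MainTermNormForm — C-L4-MAIN-INSTANCE in the NORM FORM of record: (S-MAIN) from the finite non-vanishing
display (S-FIN-NV), no phase alignment

Blind re-derivation cell `pub-hodge-repro`, Tier 4 «prove the step» (README §9–§10), seat t4-L4-p1 (prover, LINE L4,
gen 4; plan-4 g5's ruling (R2) S15484 after the finding F-L4-PHASE-PPOWER S15478).  Tree path
`lean/Summits/Ventures/HodgeRepro/Tier4/Line4/MainTermNormForm.lean`.  Mathlib-level; no literature.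

WHAT IS PROVED.  `main_term_of_displays''` — x2's (S-MAIN) display `hmain` (TailGlue) for the witness of record, from
the chain IDENTITY `orbital_eq_mul_of_chain` (HorbMain): `S.orbital … (f N) = (c c′) · (∫_{T_∞} χ I_∞) · (∫_{DZ_f} χ I_f)`,
whose archimedean factor is `c₀ · archFactor (finf ∗ e) γ₀ ≠ 0` (`integral_chi_innerInf_eq_archFactor`, `harch`) and whose
finite factor is bounded below IN NORM by the display
(S-FIN-NV) `hnv : ∃ δ > 0, ∃ N₀, ∀ N ≥ N₀, δ · suppMeasure (lev N) γ₀ ≤ ‖∫_{DZ_f} χ(b) · innerFin (levelDC (lev N)) γ₀ b dν_f‖`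
— the norm of the finite fibre integral along the level sequence `lev N = p^{N+n₁}`, replacing the pointwise phase alignment
`hδ` of `main_term_of_displays` / `'` (withdrawn along `p`-powers: F-L4-PHASE-PPOWER — `⋂_N K(p^N) = K^{(p)} ≠ {1}`,
LevelIntersection).  `m := c c′ c₀ ‖archFactor (finf ∗ e) γ₀‖ δ / C′`, `N₁ := N₀`; the chain inputs are the displayed
`ChainInputs` (MainTermInstance).  (S-FIN-NV) itself is the `p`-local alignment × the away-from-`p` non-vanishing at `γ₀`
(plan-4 S15484: LEVELINTER / PHASE-AT-P / PSPLIT / the display `c₀(γ₀) ≠ 0`).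

Nothing here says anything about the status of the Hodge conjecture for CM abelian varieties, which is NOT proved
(HC_CM is NOT proved by anyone in this repository).
-/

set_option autoImplicit false

noncomputable section

namespace Summit.Ventures.HodgeRepro.Tier4.Line4

open Summit.Ventures.HodgeRepro.Tier4 Summit.Ventures.HodgeRepro.Tier4.Common
  Summit.Ventures.HodgeRepro.Tier4.Line1 MeasureTheory
open scoped ComplexConjugate Topology Pointwise NNReal

section NormForm

variable {k : Type} [Field k] [NumberField k] (W : PlaneData k) [MeasurableSpace (GA W)] [BorelSpace (GA W)]
  (R : RTFData W) (μ : Measure (GA W)) [μ.IsHaarMeasure] [R.μT.IsHaarMeasure] [R.μT'.IsHaarMeasure]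
  (DG : Set (GA W)) (fdG : IsFundamentalDomain (rationalPoints W) DG μ) (compG : IsCompact (closure DG))
  (compT : IsCompact (closure R.DT)) (compT' : IsCompact (closure R.DT'))

/-- **`main_term_of_displays` in the NORM FORM of record (plan-4 g5 S15484, after F-L4-PHASE-PPOWER S15478)**: the
phase alignment `hδ` is replaced by the finite non-vanishing display (S-FIN-NV)
`hnv : ∃ δ > 0, ∃ N₀, ∀ N ≥ N₀, δ · suppMeasure (lev N) γ₀ ≤ ‖∫_{DZ_f} χ(b) I_f(levelDC (lev N)) γ₀ (b) dν_f‖` — the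
NORM of the finite fibre integral (no real part: on the product witness `‖arch · fin‖ = ‖arch‖ · ‖fin‖`).  From the
chain IDENTITY `orbital_eq_mul_of_chain` (HorbMain) and the archimedean factor `c₀ · archFactor (finf ∗ e) γ₀ ≠ 0`;
`m := c c′ c₀ ‖archFactor (finf ∗ e) γ₀‖ δ / C′`, `N₁ := N₀`. -/
theorem main_term_of_displays'' [MeasurableMul (torusT W)] [MeasurableMul (torusT' W)] (hR : R.IsHaar)
    (γ₀ : rationalPoints W) (hreg : IsRegularRational W γ₀)
    (νinf : Measure (torusInf W)) [νinf.IsHaarMeasure] (νf : Measure (torusFin W)) [νf.IsHaarMeasure]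
    (c : ℝ≥0) (hc0 : 0 < c) (hcμ : R.μT = c • Measure.map (torusSplit W).symm (νinf.prod νf))
    (νinf' : Measure (torusInf' W)) [νinf'.IsHaarMeasure] (νf' : Measure (torusFin' W)) [νf'.IsHaarMeasure]
    (c' : ℝ≥0) (hc0' : 0 < c') (hcμ' : R.μT' = c' • Measure.map (torusSplit' W).symm (νinf'.prod νf'))
    (DZf : Set (torusFin W)) (hDZf : MeasurableSet DZf) (hfd : IsFundamentalDomain (centreFin W) DZf νf)
    (μinf : Measure (infinitePart W)) [μinf.IsHaarMeasure] (μ₀ : Measure (finitePart W)) [μ₀.IsHaarMeasure]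
    (c₀ : ℝ≥0) (hc₀ : 0 < c₀) (hcμ₀ : μ = c₀ • Measure.map (gaSplit W).symm (μinf.prod μ₀))
    (finf e : GA W → ℂ)
    (harch : L1Class.archFactor W R (convInf W μinf finf e) (γ₀ : GA W) νinf νinf' ≠ 0)
    (p n₁ : ℕ) (hp : p ≠ 0) (C' : ℝ) (hC' : 0 < C')
    -- (S-FIN-NV)
    (hnv : ∃ δ : ℝ, 0 < δ ∧ ∃ N₀ : ℕ, ∀ N ≥ N₀,
      δ * (suppMeasure W νf νf' (γ₀ : GA W) DZf (p ^ (N + n₁)) (γ₀ : GA W)).toReal ≤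
        ‖∫ b in DZf, R.chi b * innerFin W R (levelDC W (γ₀ : GA W) (p ^ (N + n₁))) (γ₀ : GA W) νf' b ∂νf‖)
    (hchain : ∀ N : ℕ, ChainInputs W R γ₀ νinf νf νinf' νf' DZf
      ((Setting.ofAdelicData W R μ DG fdG compG compT compT').conv
        (L1Class.prodFn W finf (ffinMuNat W μ₀ (γ₀ : GA W) (fun n => p ^ (n + n₁)) (p ^ (N + n₁))))
        (testNat W e (p ^ (N + n₁))))
      (fun x => (c₀ : ℂ) * convInf W μinf finf e x) (levelDC W (γ₀ : GA W) (p ^ (N + n₁)))) :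
    ∃ m : ℝ, 0 < m ∧ ∃ N₁ : ℕ, ∀ N ≥ N₁,
      m * (C' * (suppMeasure W νf νf' (γ₀ : GA W) DZf (p ^ (N + n₁)) (γ₀ : GA W)).toReal) ≤
        ‖(Setting.ofAdelicData W R μ DG fdG compG compT compT').orbital R.chi R.chi'
          ((Setting.ofAdelicData W R μ DG fdG compG compT compT').orbitOf γ₀)
          ((Setting.ofAdelicData W R μ DG fdG compG compT compT').conv
            (L1Class.prodFn W finf (ffinMuNat W μ₀ (γ₀ : GA W) (fun n => p ^ (n + n₁)) (p ^ (N + n₁))))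
            (testNat W e (p ^ (N + n₁))))‖ := by
  obtain ⟨δ, hδpos, N₀, hnv⟩ := hnv
  set AF : ℂ := L1Class.archFactor W R (convInf W μinf finf e) (γ₀ : GA W) νinf νinf' with hAF
  have hAFpos : 0 < ‖AF‖ := norm_pos_iff.2 harch
  refine ⟨(c : ℝ) * (c' : ℝ) * (c₀ : ℝ) * ‖AF‖ * δ * C'⁻¹, ?_, N₀, fun N hN₀ => ?_⟩
  · apply mul_pos _ (inv_pos.2 hC')
    apply mul_pos (mul_pos (mul_pos (mul_pos _ _) _) hAFpos) hδpos
    · exact_mod_cast hc0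
    · exact_mod_cast hc0'
    · exact_mod_cast hc₀
  have hN : p ^ (N + n₁) ≠ 0 := pow_ne_zero _ hp
  set F : GA W → ℂ := (Setting.ofAdelicData W R μ DG fdG compG compT compT').conv
    (L1Class.prodFn W finf (ffinMuNat W μ₀ (γ₀ : GA W) (fun n => p ^ (n + n₁)) (p ^ (N + n₁))))
    (testNat W e (p ^ (N + n₁))) with hFdef
  have hF : ∀ g, F g = (fun x => (c₀ : ℂ) * convInf W μinf finf e x) (GA.ofInfPart W g) *
      levelDC W (γ₀ : GA W) (p ^ (N + n₁)) (GA.ofFinPart W g) := by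
    intro g
    have hlev : ffinMuNat W μ₀ (γ₀ : GA W) (fun n => p ^ (n + n₁)) (p ^ (N + n₁)) =
        ffinMu W μ₀ (γ₀ : GA W) (p ^ (N + n₁)) := ffinMuNat_lev W μ₀ (γ₀ : GA W) (lev := fun n => p ^ (n + n₁)) (n := N) hN
    have hprod := isProductFn_conv' W μ μinf μ₀ c₀ hcμ₀
      (L1Class.isProductFn_prodFn W finf (ffinMuNat W μ₀ (γ₀ : GA W) (fun n => p ^ (n + n₁)) (p ^ (N + n₁))))
      (L1Class.isProductFn_prodFn W e (levelInd W (p ^ (N + n₁)))) g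
    rw [hFdef, testNat_of_ne_zero W e hN]
    change conv W μ _ _ g = _
    rw [hprod, hlev, convFin_ffinMu_levelInd W (γ₀ : GA W) (p ^ (N + n₁)) μ₀ hN, levelDC_ofFinPart]
  obtain ⟨hA1, hA2, hA3, hA4, hs, hB1, hB2, hB3, hB4, hA, hB, hIinf, hIfin, -⟩ := hchain N
  rw [orbital_eq_mul_of_chain W R μ DG fdG compG compT compT' hR F
    (fun x => (c₀ : ℂ) * convInf W μinf finf e x) (levelDC W (γ₀ : GA W) (p ^ (N + n₁))) hF γ₀ hreg
    νinf νf c hcμ νinf' νf' c' hcμ' DZf hDZf hfd hA1 hA2 hA3 hA4 hs hB1 hB2 hB3 hB4 hA hB hIinf hIfin,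
    integral_chi_innerInf_eq_archFactor W R μinf c₀ finf e (γ₀ : GA W) νinf νinf', ← hAF]
  simp only [norm_mul, Complex.norm_real, Real.norm_eq_abs, NNReal.abs_eq]
  have hfin := hnv N hN₀
  have hpos : 0 ≤ (c : ℝ) * (c' : ℝ) * ((c₀ : ℝ) * ‖AF‖) := by positivity
  have key : (c : ℝ) * (c' : ℝ) * ((c₀ : ℝ) * ‖AF‖) *
      (δ * (suppMeasure W νf νf' (γ₀ : GA W) DZf (p ^ (N + n₁)) (γ₀ : GA W)).toReal) ≤
      (c : ℝ) * (c' : ℝ) * ((c₀ : ℝ) * ‖AF‖) *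
        ‖∫ b in DZf, R.chi b * innerFin W R (levelDC W (γ₀ : GA W) (p ^ (N + n₁))) (γ₀ : GA W) νf' b ∂νf‖ :=
    mul_le_mul_of_nonneg_left hfin hpos
  refine le_of_eq_of_le ?_ (le_of_le_of_eq key ?_)
  · rw [show (c : ℝ) * (c' : ℝ) * (c₀ : ℝ) * ‖AF‖ * δ * C'⁻¹ *
        (C' * (suppMeasure W νf νf' (γ₀ : GA W) DZf (p ^ (N + n₁)) (γ₀ : GA W)).toReal) =
      (c : ℝ) * (c' : ℝ) * ((c₀ : ℝ) * ‖AF‖) *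
        (δ * (suppMeasure W νf νf' (γ₀ : GA W) DZf (p ^ (N + n₁)) (γ₀ : GA W)).toReal) * (C'⁻¹ * C') by ring,
      inv_mul_cancel₀ hC'.ne', mul_one]
  · ring

end NormForm

end Summit.Ventures.HodgeRepro.Tier4.Line4

end
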